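import Mathlib
import Literature.AlgebraicGeometry.Morphisms.CechH1Pullback
import HarnessLib

/-!
# Čech `Ȟ¹(𝒰, 𝒪)` commutes with localisation of an affine base (flat base change along
# `Spec S⁻¹A → Spec A`)

For an `A`-scheme `f : X → Spec A`, a submonoid `S ⊆ A` with localisation `A → A' = S⁻¹A`, and the
base change `g : Y = X ×_{Spec A} Spec A' → X` (a cartesian square `IsPullback g f' f (Spec A' → Spec A)`),
the pullback maps of `Morphisms/CechH1Pullback` on sections, Čech cochains and `Ȟ¹` (for a FINITE family
of AFFINE opens `𝒰 = (U_i)` of `X` whose pairwise and triple intersections are affine — e.g. any finite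
affine open cover of a separated `X`) are LOCALISATION MAPS at `S`:

* `isLocalizedModule_sectionsComap_of_isAffineOpen` — `Γ(Y, g⁻¹V) = S⁻¹ Γ(X, V)` for `V` affine (Mathlib's
  affine base change of sections `isIso_pushoutSection_of_isAffineOpen`, read through
  `CommRingCat.isPushout_iff_isPushout` and `isLocalizedModule_iff_isBaseChange`);
* `isLocalizedModule_cechComapC0/C1/C2` — the cochain groups localise (finite products);
* `isLocalizedModule_cechComapZ1`, `isLocalizedModule_cechComapH1` — cocycles and `Ȟ¹` localise
  (localisation is exact: Mathlib `LinearMap.toKerLocalized_isLocalizedModule`,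
  `IsLocalizedModule.toLocalizedQuotient'`).

The `A`-structure of `Y` is carried as a morphism `f_Y : Y → Spec A` with the hypothesis
`hfY : f_Y = f_Y' ≫ (Spec A' → Spec A)` (so that the statements are literally about the maps of
`Morphisms/CechH1Pullback` for `g ≫ f_X = f_Y`, `comp_eq`); no definition is introduced.
This is the Čech form of FLAT BASE CHANGE for `H¹` along a localisation (EGA III (1.4.15);
Hartshorne III Prop. 9.3; The Stacks Project, Tag 02KH), proved cochain-wise without derived functors;
written for the W4.4 support programme «P_G LERAY» (res-D-pv-045, PG-LERAY-NOTE block (K3)), where it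
computes `Ȟ¹` of the base change of a resolution to the local scheme `Spec 𝒪_{Y,y}` of a point.
Mathlib searched (pin v4.32): `isIso_pushoutSection_of_isAffineOpen`, `CommRingCat.isPushout_iff_isPushout`,
`isLocalizedModule_iff_isBaseChange`, `IsLocalizedModule.pi`, `LinearMap.toKerLocalized_isLocalizedModule`,
`IsLocalizedModule.toLocalizedQuotient'` (used); Mathlib has no Čech cohomology of schemes.

## References
* A. Grothendieck, J. Dieudonné, EGA III₁ (Publ. Math. IHÉS 11, 1961), Prop. (1.4.15). [EGAIII1]
* R. Hartshorne, *Algebraic Geometry*, GTM 52 (1977), III Prop. 9.3. [Hartshorne1977]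
* The Stacks Project, Tag 02KH (flat base change of cohomology), Tag 01ED. [StacksProject]
-/

noncomputable section

open CategoryTheory AlgebraicGeometry Limits TopologicalSpace Opposite

universe u v

namespace Literature.AlgebraicGeometry.Morphisms

namespace CechLocalization

variable {A : Type u} [CommRing A] (S : Submonoid A) {A' : Type u} [CommRing A'] [Algebra A A']
  [IsLocalization S A']
  {X Y : Scheme.{u}} (fX : X ⟶ Spec (.of A)) (fY' : Y ⟶ Spec (.of A')) (fY : Y ⟶ Spec (.of A))
  (g : Y ⟶ X) (hfY : fY = fY' ≫ Spec.map (CommRingCat.ofHom (algebraMap A A')))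
  (H : IsPullback g fY' fX (Spec.map (CommRingCat.ofHom (algebraMap A A'))))

include hfY H in
/-- The base-change projection is a morphism of `A`-schemes: `g ≫ f_X = f_Y` for the `A`-structure
`f_Y = f_Y' ≫ (Spec A' → Spec A)` of `Y` (private plumbing; any proof of `g ≫ f_X = f_Y` may be
supplied by users, by proof irrelevance). [folklore] -/
private theorem comp_eq : g ≫ fX = fY := by
  rw [hfY]; exact H.w

/-! ## Sections over an affine open localise -/

section Affine

variable (V : X.Opens)

include hfY H in
/-- **`Γ(Y, g⁻¹V) = S⁻¹Γ(X, V)` for `V` affine**: the pullback of sections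
`g^* : Γ(X, V) → Γ(Y, g⁻¹V)` is a localisation map at `S` (as `A`-modules).  Mathlib's affine base
change of sections (`isIso_pushoutSection_of_isAffineOpen`: the square `A → Γ(X, V)`, `A → A'`,
`Γ(X, V) → Γ(Y, g⁻¹V)`, `A' → Γ(Y, g⁻¹V)` is a pushout of rings, i.e. `Γ(Y, g⁻¹V) = Γ(X, V) ⊗_A A'`),
read through `CommRingCat.isPushout_iff_isPushout` and `isLocalizedModule_iff_isBaseChange`.
[cite: EGAIII1, Prop. (1.4.15)] -/
theorem isLocalizedModule_sectionsComap_of_isAffineOpen (hV : IsAffineOpen V) :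
    IsLocalizedModule S (Sections.comap fX fY g (comp_eq fX fY' fY g hfY H)
      (le_refl (g ⁻¹ᵁ V))).toLinearMap := by
  subst hfY
  -- `Γ(Y, g⁻¹V)` as an `A'`-algebra (through `f_Y'`), compatibly with its `A`-structure
  letI : Algebra A' (Sections (fY' ≫ Spec.map (CommRingCat.ofHom (algebraMap A A'))) (g ⁻¹ᵁ V)) :=
    inferInstanceAs (Algebra A' (Sections fY' (g ⁻¹ᵁ V)))
  haveI : IsScalarTower A A'
      (Sections (fY' ≫ Spec.map (CommRingCat.ofHom (algebraMap A A'))) (g ⁻¹ᵁ V)) := by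
    refine IsScalarTower.of_algebraMap_eq fun a => ?_
    change Y.presheaf.map (homOfLE le_top).op
        (algebraMapΓ (fY' ≫ Spec.map (CommRingCat.ofHom (algebraMap A A'))) a) =
      Y.presheaf.map (homOfLE le_top).op (algebraMapΓ fY' (algebraMap A A' a))
    congr 1
    change ((fY' ≫ Spec.map (CommRingCat.ofHom (algebraMap A A'))).appTop.hom.comp
        (Scheme.ΓSpecIso (.of A)).inv.hom) a =
      (fY'.appTop.hom.comp (Scheme.ΓSpecIso (.of A')).inv.hom) (algebraMap A A' a)
    have hnat := Scheme.ΓSpecIso_inv_naturality (CommRingCat.ofHom (algebraMap A A'))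
    rw [Scheme.Hom.comp_appTop]
    change (fY'.appTop.hom) (((Scheme.ΓSpecIso (.of A)).inv ≫
        (Spec.map (CommRingCat.ofHom (algebraMap A A'))).appTop).hom a) =
      fY'.appTop.hom ((Scheme.ΓSpecIso (.of A')).inv.hom (algebraMap A A' a))
    rw [← hnat]
    rfl
  -- `Γ(Y, g⁻¹V)` as a `Γ(X, V)`-algebra through `g^*`, compatibly with the `A`-structures
  letI : Algebra (Sections fX V)
      (Sections (fY' ≫ Spec.map (CommRingCat.ofHom (algebraMap A A'))) (g ⁻¹ᵁ V)) :=
    (g.appLE V (g ⁻¹ᵁ V) le_rfl).hom.toAlgebra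
  haveI : IsScalarTower A (Sections fX V)
      (Sections (fY' ≫ Spec.map (CommRingCat.ofHom (algebraMap A A'))) (g ⁻¹ᵁ V)) :=
    IsScalarTower.of_algebraMap_eq fun a =>
      ((Sections.comap fX _ g (comp_eq fX fY' _ g rfl H) (le_refl (g ⁻¹ᵁ V))).commutes a).symm
  -- Mathlib's cartesian-square statement, with `U_S = ⊤`, `U_T = ⊤`, `U_X = V`, `U_Y = g⁻¹V`
  have hsq := (isIso_pushoutSection_iff H (US := ⊤) (UT := ⊤) (UX := V) le_top le_top
      (UY := g ⁻¹ᵁ V) (by simp)).mp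
    (isIso_pushoutSection_of_isAffineOpen H le_top le_top (by simp) (isAffineOpen_top _)
      (isAffineOpen_top _) hV)
  -- replace the corners `Γ(Spec A, ⊤)`, `Γ(Spec A', ⊤)` by `A`, `A'`
  have hsq' : IsPushout (CommRingCat.ofHom (algebraMap A (Sections fX V)))
      (CommRingCat.ofHom (algebraMap A A'))
      (CommRingCat.ofHom (algebraMap (Sections fX V)
        (Sections (fY' ≫ Spec.map (CommRingCat.ofHom (algebraMap A A'))) (g ⁻¹ᵁ V))))
      (CommRingCat.ofHom (algebraMap A'
        (Sections (fY' ≫ Spec.map (CommRingCat.ofHom (algebraMap A A'))) (g ⁻¹ᵁ V)))) := by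
    refine IsPushout.of_iso hsq (Scheme.ΓSpecIso (.of A)) (Iso.refl _) (Scheme.ΓSpecIso (.of A'))
      (Iso.refl _) ?_ ?_ ?_ ?_
    · -- `A → Γ(X, V)`
      simp only [Iso.refl_hom]
      rw [← Iso.inv_comp_eq]
      rfl
    · -- `A → A'`
      have happ : (Spec.map (CommRingCat.ofHom (algebraMap A A'))).appLE ⊤ ⊤ le_top =
          (Spec.map (CommRingCat.ofHom (algebraMap A A'))).appTop := rfl
      rw [happ]
      exact Scheme.ΓSpecIso_naturality _
    · -- `Γ(X, V) → Γ(Y, g⁻¹V)`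
      simp only [Iso.refl_hom]
      rfl
    · -- `A' → Γ(Y, g⁻¹V)`
      simp only [Iso.refl_hom]
      rw [← Iso.inv_comp_eq]
      rfl
  have hP : Algebra.IsPushout A A' (Sections fX V)
      (Sections (fY' ≫ Spec.map (CommRingCat.ofHom (algebraMap A A'))) (g ⁻¹ᵁ V)) :=
    CommRingCat.isPushout_iff_isPushout.mp hsq'.flip
  have h := hP.out
  rw [← isLocalizedModule_iff_isBaseChange S A'] at h
  have e : (Sections.comap fX _ g (comp_eq fX fY' _ g rfl H) (le_refl (g ⁻¹ᵁ V))).toLinearMap =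
      (IsScalarTower.toAlgHom A (Sections fX V)
        (Sections (fY' ≫ Spec.map (CommRingCat.ofHom (algebraMap A A'))) (g ⁻¹ᵁ V))).toLinearMap := by
    ext x; rfl
  rw [e]
  exact h

end Affine

/-! ## Cochains localise -/

section Cochains

variable {ι : Type v} [Finite ι] (U : ι → X.Opens)

include hfY H in
/-- **`Č⁰(g⁻¹𝒰, 𝒪_Y) = S⁻¹Č⁰(𝒰, 𝒪_X)`** for a finite family of affine opens. [cite: EGAIII1, Prop. (1.4.15)] -/
theorem isLocalizedModule_cechComapC0 (hU : ∀ i, IsAffineOpen (U i)) :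
    IsLocalizedModule S (cechComapC0 fX fY g (comp_eq fX fY' fY g hfY H) U) := by
  haveI := fun i => isLocalizedModule_sectionsComap_of_isAffineOpen S fX fY' fY g hfY H (U i) (hU i)
  have e : cechComapC0 fX fY g (comp_eq fX fY' fY g hfY H) U =
      LinearMap.pi fun i => (Sections.comap fX fY g (comp_eq fX fY' fY g hfY H)
        (le_refl (g ⁻¹ᵁ U i))).toLinearMap ∘ₗ LinearMap.proj i := by
    ext b i; rfl
  rw [e]
  exact IsLocalizedModule.pi S _

include hfY H in
/-- **`Č¹(g⁻¹𝒰, 𝒪_Y) = S⁻¹Č¹(𝒰, 𝒪_X)`** when the pairwise intersections `U_i ∩ U_j` are affine.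
[cite: EGAIII1, Prop. (1.4.15)] -/
theorem isLocalizedModule_cechComapC1 (hU2 : ∀ i j, IsAffineOpen (U i ⊓ U j)) :
    IsLocalizedModule S (cechComapC1 fX fY g (comp_eq fX fY' fY g hfY H) U) := by
  -- the localisation maps on each `U_i ∩ U_j` (target `g⁻¹U_i ∩ g⁻¹U_j = g⁻¹(U_i ∩ U_j)`)
  let φ : ∀ i j, Sections fX (U i ⊓ U j) →ₗ[A]
      Sections fY (preimageFamily g U i ⊓ preimageFamily g U j) := fun i j =>
    (Sections.comap fX fY g (comp_eq fX fY' fY g hfY H)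
      (show preimageFamily g U i ⊓ preimageFamily g U j ≤ g ⁻¹ᵁ (U i ⊓ U j) from
        fun _ hx => hx)).toLinearMap
  haveI hφ : ∀ i j, IsLocalizedModule S (φ i j) := fun i j =>
    isLocalizedModule_sectionsComap_of_isAffineOpen S fX fY' fY g hfY H (U i ⊓ U j) (hU2 i j)
  haveI hrow : ∀ i, IsLocalizedModule S
      (LinearMap.pi fun j => φ i j ∘ₗ LinearMap.proj j :
        (∀ j, Sections fX (U i ⊓ U j)) →ₗ[A]
          ∀ j, Sections fY (preimageFamily g U i ⊓ preimageFamily g U j)) :=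
    fun i => IsLocalizedModule.pi S _
  have e : cechComapC1 fX fY g (comp_eq fX fY' fY g hfY H) U =
      LinearMap.pi fun i => (LinearMap.pi fun j => φ i j ∘ₗ LinearMap.proj j) ∘ₗ
        LinearMap.proj i := by
    ext c i j; rfl
  rw [e]
  exact IsLocalizedModule.pi S _

include hfY H in
/-- **`Č²(g⁻¹𝒰, 𝒪_Y) = S⁻¹Č²(𝒰, 𝒪_X)`** when the triple intersections are affine.
[cite: EGAIII1, Prop. (1.4.15)] -/
theorem isLocalizedModule_cechComapC2 (hU3 : ∀ i j k, IsAffineOpen (U i ⊓ U j ⊓ U k)) :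
    IsLocalizedModule S (cechComapC2 fX fY g (comp_eq fX fY' fY g hfY H) U) := by
  let φ : ∀ i j k, Sections fX (U i ⊓ U j ⊓ U k) →ₗ[A]
      Sections fY
        (preimageFamily g U i ⊓ preimageFamily g U j ⊓ preimageFamily g U k) := fun i j k =>
    (Sections.comap fX fY g (comp_eq fX fY' fY g hfY H)
      (show preimageFamily g U i ⊓ preimageFamily g U j ⊓ preimageFamily g U k ≤
          g ⁻¹ᵁ (U i ⊓ U j ⊓ U k) from fun _ hx => hx)).toLinearMap
  haveI hφ : ∀ i j k, IsLocalizedModule S (φ i j k) := fun i j k =>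
    isLocalizedModule_sectionsComap_of_isAffineOpen S fX fY' fY g hfY H (U i ⊓ U j ⊓ U k) (hU3 i j k)
  haveI hrow : ∀ i j, IsLocalizedModule S
      (LinearMap.pi fun k => φ i j k ∘ₗ LinearMap.proj k :
        (∀ k, Sections fX (U i ⊓ U j ⊓ U k)) →ₗ[A]
          ∀ k, Sections fY
            (preimageFamily g U i ⊓ preimageFamily g U j ⊓ preimageFamily g U k)) :=
    fun i j => IsLocalizedModule.pi S _
  haveI hpl : ∀ i, IsLocalizedModule S
      (LinearMap.pi fun j => (LinearMap.pi fun k => φ i j k ∘ₗ LinearMap.proj k) ∘ₗ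
        LinearMap.proj j :
        (∀ j k, Sections fX (U i ⊓ U j ⊓ U k)) →ₗ[A]
          ∀ j k, Sections fY
            (preimageFamily g U i ⊓ preimageFamily g U j ⊓ preimageFamily g U k)) :=
    fun i => IsLocalizedModule.pi S _
  have e : cechComapC2 fX fY g (comp_eq fX fY' fY g hfY H) U =
      LinearMap.pi fun i => (LinearMap.pi fun j =>
        (LinearMap.pi fun k => φ i j k ∘ₗ LinearMap.proj k) ∘ₗ LinearMap.proj j) ∘ₗ
          LinearMap.proj i := by
    ext c i j k; rfl
  rw [e]
  exact IsLocalizedModule.pi S _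

end Cochains

/-! ## Cocycles and `Ȟ¹` localise (localisation is exact) -/

section H1

variable {ι : Type v} [Finite ι] (U : ι → X.Opens)

include hfY H in
/-- **`Ž¹(g⁻¹𝒰, 𝒪_Y) = S⁻¹Ž¹(𝒰, 𝒪_X)`**: the pullback of cocycles is a localisation map (kernels
commute with localisation, Mathlib `LinearMap.toKerLocalized_isLocalizedModule`; the differential of `Y`
is the localisation of the differential of `X`, `cechD1_comapC1`). [cite: EGAIII1, Prop. (1.4.15)] -/
theorem isLocalizedModule_cechComapZ1 (hU2 : ∀ i j, IsAffineOpen (U i ⊓ U j))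
    (hU3 : ∀ i j k, IsAffineOpen (U i ⊓ U j ⊓ U k)) :
    IsLocalizedModule S (cechComapZ1 fX fY g (comp_eq fX fY' fY g hfY H) U) := by
  haveI h1 := isLocalizedModule_cechComapC1 S fX fY' fY g hfY H U hU2
  haveI h2 := isLocalizedModule_cechComapC2 S fX fY' fY g hfY H U hU3
  set f1 := cechComapC1 fX fY g (comp_eq fX fY' fY g hfY H) U with hf1
  set f2 := cechComapC2 fX fY g (comp_eq fX fY' fY g hfY H) U with hf2
  -- `d¹_Y` is the localisation of `d¹_X`
  have hmap : IsLocalizedModule.map S f1 f2 (cechD1 fX U) =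
      cechD1 fY (preimageFamily g U) := by
    apply IsLocalizedModule.linearMap_ext S f1 f2
    rw [IsLocalizedModule.map_comp]
    ext c i j k
    exact congrFun (congrFun (congrFun (cechD1_comapC1 fX fY g
      (comp_eq fX fY' fY g hfY H) U c).symm i) j) k
  -- kernels localise (the `S⁻¹A`-module structures on the cochains of `Y` come from the localisation maps)
  letI : Module (Localization S) (CechC1 fY (preimageFamily g U)) :=
    IsLocalizedModule.module S f1
  haveI : IsScalarTower A (Localization S) (CechC1 fY (preimageFamily g U)) :=
    IsLocalizedModule.isScalarTower_module S f1
  letI : Module (Localization S) (CechC2 fY (preimageFamily g U)) :=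
    IsLocalizedModule.module S f2
  haveI : IsScalarTower A (Localization S) (CechC2 fY (preimageFamily g U)) :=
    IsLocalizedModule.isScalarTower_module S f2
  haveI hker : IsLocalizedModule S (LinearMap.toKerIsLocalized S f1 f2 (cechD1 fX U)) :=
    LinearMap.toKerLocalized_isLocalizedModule (Localization S) S f1 f2 (cechD1 fX U)
  have hk : LinearMap.ker (IsLocalizedModule.map S f1 f2 (cechD1 fX U)) =
      cechZ1 fY (preimageFamily g U) := by
    rw [hmap]; rfl
  let e : ↥(LinearMap.ker (IsLocalizedModule.map S f1 f2 (cechD1 fX U))) ≃ₗ[A]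
      ↥(cechZ1 fY (preimageFamily g U)) := LinearEquiv.ofEq _ _ hk
  have hcomp : cechComapZ1 fX fY g (comp_eq fX fY' fY g hfY H) U =
      e.toLinearMap ∘ₗ LinearMap.toKerIsLocalized S f1 f2 (cechD1 fX U) := by
    apply LinearMap.ext; intro z; apply Subtype.ext; rfl
  rw [hcomp]
  exact IsLocalizedModule.of_linearEquiv (hf := hker) S _ e

include hfY H in
/-- **FLAT BASE CHANGE OF ČECH `H¹` ALONG A LOCALISATION: `Ȟ¹(g⁻¹𝒰, 𝒪_Y) = S⁻¹ Ȟ¹(𝒰, 𝒪_X)`.**  For an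
`A`-scheme `f_X : X → Spec A`, `A → A' = S⁻¹A`, the base change `g : Y = X ×_A Spec A' → X`, and a finite
family `𝒰` of affine opens of `X` with affine pairwise and triple intersections, the pullback
`g^* : Ȟ¹(𝒰, 𝒪_X) → Ȟ¹(g⁻¹𝒰, 𝒪_Y)` of `Morphisms/CechH1Pullback` is a localisation map at `S`
(cocycles localise, `isLocalizedModule_cechComapZ1`; coboundaries are the localised range of `d⁰`,
Mathlib `LinearMap.range_localizedMap_eq_localized₀_range`; quotients localise,
`IsLocalizedModule.toLocalizedQuotient'`).  [cite: EGAIII1, Prop. (1.4.15)] -/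
theorem isLocalizedModule_cechComapH1 (hU : ∀ i, IsAffineOpen (U i))
    (hU2 : ∀ i j, IsAffineOpen (U i ⊓ U j)) (hU3 : ∀ i j k, IsAffineOpen (U i ⊓ U j ⊓ U k)) :
    IsLocalizedModule S (cechComapH1 fX fY g (comp_eq fX fY' fY g hfY H) U) := by
  haveI h0 := isLocalizedModule_cechComapC0 S fX fY' fY g hfY H U hU
  haveI h1 := isLocalizedModule_cechComapC1 S fX fY' fY g hfY H U hU2
  haveI hZ := isLocalizedModule_cechComapZ1 S fX fY' fY g hfY H U hU2 hU3
  set f0 := cechComapC0 fX fY g (comp_eq fX fY' fY g hfY H) U with hf0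
  set f1 := cechComapC1 fX fY g (comp_eq fX fY' fY g hfY H) U with hf1
  set fZ := cechComapZ1 fX fY g (comp_eq fX fY' fY g hfY H) U with hfZ
  -- the `S⁻¹A`-module structure on the cocycles of `Y`
  letI : Module (Localization S) ↥(cechZ1 fY (preimageFamily g U)) :=
    IsLocalizedModule.module S fZ
  haveI : IsScalarTower A (Localization S) ↥(cechZ1 fY (preimageFamily g U)) :=
    IsLocalizedModule.isScalarTower_module S fZ
  -- `d⁰_Y` is the localisation of `d⁰_X`, so `B¹_Y = S⁻¹B¹_X`
  have hmap0 : IsLocalizedModule.map S f0 f1 (cechD0 fX U) =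
      cechD0 fY (preimageFamily g U) := by
    apply IsLocalizedModule.linearMap_ext S f0 f1
    rw [IsLocalizedModule.map_comp]
    ext b i j
    exact congrFun (congrFun (cechD0_comapC0 fX fY g
      (comp_eq fX fY' fY g hfY H) U b).symm i) j
  have hB : cechB1 fY (preimageFamily g U) =
      (cechB1 fX U).localized₀ S f1 := by
    rw [cechB1, cechB1, ← hmap0]
    exact LinearMap.range_localizedMap_eq_localized₀_range S f0 f1 (cechD0 fX U)
  -- the submodules by which one divides
  set M' : Submodule A ↥(cechZ1 fX U) := (cechB1 fX U).comap (cechZ1 fX U).subtype with hM'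
  set M'Y : Submodule A ↥(cechZ1 fY (preimageFamily g U)) :=
    (cechB1 fY (preimageFamily g U)).comap
      (cechZ1 fY (preimageFamily g U)).subtype with hM'Y
  have key : (M'.localized' (Localization S) S fZ).restrictScalars A = M'Y := by
    rw [Submodule.restrictScalars_localized']
    ext z
    rw [Submodule.mem_localized₀, hM'Y, Submodule.mem_comap, Submodule.subtype_apply, hB,
      Submodule.mem_localized₀]
    constructor
    · rintro ⟨b, hb, s, hbs⟩
      refine ⟨(b : CechC1 fX U), hb, s, ?_⟩
      rw [← hbs, IsLocalizedModule.mk'_eq_iff]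
      change f1 (b : CechC1 fX U) =
        ((s • IsLocalizedModule.mk' fZ b s : ↥(cechZ1 fY (preimageFamily g U))) :
          CechC1 fY (preimageFamily g U))
      rw [IsLocalizedModule.mk'_cancel']
      rfl
    · rintro ⟨b, hb, s, hbs⟩
      have hbZ : b ∈ cechZ1 fX U := cechB1_le_cechZ1 fX U hb
      refine ⟨⟨b, hbZ⟩, hb, s, ?_⟩
      rw [IsLocalizedModule.mk'_eq_iff]
      apply Subtype.ext
      change f1 b = s • (z : CechC1 fY (preimageFamily g U))
      rw [← IsLocalizedModule.mk'_eq_iff]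
      exact hbs
  -- quotients localise
  haveI hq := IsLocalizedModule.toLocalizedQuotient' (Localization S) S fZ M'
  let e1 : (↥(cechZ1 fY (preimageFamily g U)) ⧸ M'Y) ≃ₗ[A]
      (↥(cechZ1 fY (preimageFamily g U)) ⧸
        (M'.localized' (Localization S) S fZ).restrictScalars A) :=
    Submodule.quotEquivOfEq _ _ key.symm
  let e2 : (↥(cechZ1 fY (preimageFamily g U)) ⧸
        (M'.localized' (Localization S) S fZ).restrictScalars A) ≃ₗ[A]
      (↥(cechZ1 fY (preimageFamily g U)) ⧸ M'.localized' (Localization S) S fZ) :=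
    Submodule.Quotient.restrictScalarsEquiv A _
  have hcomp : cechComapH1 fX fY g (comp_eq fX fY' fY g hfY H) U =
      (e1.trans e2).symm.toLinearMap ∘ₗ M'.toLocalizedQuotient' (Localization S) S fZ := by
    apply Submodule.linearMap_qext
    apply LinearMap.ext
    intro z
    rfl
  rw [hcomp]
  exact IsLocalizedModule.of_linearEquiv (hf := hq) S _ (e1.trans e2).symm

end H1

end CechLocalization

end Literature.AlgebraicGeometry.Morphisms

end
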